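import Literature.NumberTheory.LFunctions.RudnickSarnakPairCount
import Literature.NumberTheory.LFunctions.RudnickSarnakLocal
import HarnessLib

/-!
# Rudnick–Sarnak at level `n = 2`: removing Montgomery's weight and renormalising `Lγ/2π ↦ γ̃`

Proofs only (no definitions, no named facts). Fourth instalment towards the named fact
`Literature.NumberTheory.LFunctions.rudnick_sarnak_unrestricted` (Rudnick–Sarnak, Duke Math. J.
**81** (1996), Theorem 3.2 for `m = 1`) at level `n = 2`: the passage from Montgomery's
`(1/N(T)) ∑ w(γ − γ') g(L(γ − γ')/2π)` (`RudnickSarnakPairSmoothed.lean`) to Rudnick–Sarnak's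
`(1/N(T)) ∑ g(γ̃ − γ̃')`, i.e. RS (3.71)–(3.77) at `n = 2` together with `w → 1`:

* `RudnickSarnak.abs_mul_log_sub_mul_log_sub_le` — for `T/L² ≤ a, b ≤ T`,
  `|b log b − a log a − L(b − a)| ≤ (2 log L + 1)|b − a|` (elementary: `log x ≤ x − 1`);
* `RudnickSarnak.norm_sub_weight_mul_le` — the pointwise estimate for one pair (weight removal
  `1 − w(u) ≤ u²/4 = π² y²/L²`; low pairs; near pairs by the Lipschitz bound; far pairs by decay);
* `RudnickSarnak.sum_norm_sub_weight_mul_le` — the deterministic master estimate at height `T`,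
  from the window bound at scale `1/log T` (`RudnickSarnakPairCount.lean`), unit windows in
  both variables and the shell lemma `sum_inv_one_add_abs_sub_sq_le` (`RudnickSarnakLocal.lean`);
* `RudnickSarnak.eventually_sum_norm_sub_weight_mul_le` — under RH, for `g` with
  `‖g(y)‖ ≤ C_g(1 + |y|)^{-6}` and `K`-Lipschitz: for every `ε > 0` and all large `T`,
  `∑_{i,j < N(T)} ‖g(γ̃_i − γ̃_j) − w(γ_i − γ_j) g(L(γ_i − γ_j)/2π)‖ ≤ ε N(T)`.

## References

* Z. Rudnick, P. Sarnak, Duke Math. J. 81 (1996): Thm. 3.2, (3.71)–(3.77).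
* H. L. Montgomery, Proc. Sympos. Pure Math. 24 (1973): Theorem, (1), §3.
* E. C. Titchmarsh, *The Theory of the Riemann Zeta-Function* (1986), Thms. 9.2, 9.4.
-/

noncomputable section

open Filter MeasureTheory Complex Finset Set
open scoped Real Topology FourierTransform

namespace Literature.NumberTheory.LFunctions

namespace RudnickSarnak

/-! ## Removing the weight and renormalising: pointwise estimates -/

/-- `0 ≤ 1 − w(u) ≤ u²/4`. [cite: Montgomery1973, §1 (1)] -/
theorem one_sub_montgomeryWeight_mem (u : ℝ) :
    0 ≤ 1 - montgomeryWeight u ∧ 1 - montgomeryWeight u ≤ u ^ 2 / 4 := by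
  have h4 : 0 < 4 + u ^ 2 := by positivity
  have hw : 1 - montgomeryWeight u = u ^ 2 / (4 + u ^ 2) := by
    rw [montgomeryWeight]
    field_simp
    ring
  rw [hw]
  exact ⟨by positivity, div_le_div_of_nonneg_left (sq_nonneg u) (by norm_num) (by nlinarith)⟩

/-- **The two normalisations agree on high pairs.** For `T/L² ≤ a, b ≤ T` (`L = log T`,
`log L ≥ 0`): `|b log b − a log a − L (b − a)| ≤ (2 log L + 1) |b − a|`
(`b log b − a log a = (b − a) log b + a log(b/a)`, `0 ≤ a log(b/a) ≤ b − a`,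
`L − 2 log L ≤ log b ≤ L`). This is RS's passage `(L/2π)γ ↦ γ̃` ((3.71)–(3.77)) at `n = 2`.
[cite: RudnickSarnak1996, (3.71)–(3.77)] -/
theorem abs_mul_log_sub_mul_log_sub_le {T a b : ℝ} (hT : 1 < T) (hL : 0 ≤ Real.log (Real.log T))
    (ha : T / Real.log T ^ 2 ≤ a) (hb : T / Real.log T ^ 2 ≤ b) (haT : a ≤ T) (hbT : b ≤ T) :
    |b * Real.log b - a * Real.log a - Real.log T * (b - a)| ≤
      (2 * Real.log (Real.log T) + 1) * |b - a| := by
  have hLpos : 0 < Real.log T := Real.log_pos hT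
  have hT0 : 0 < T := by linarith
  have hT' : 0 < T / Real.log T ^ 2 := by positivity
  have hlogT' : Real.log (T / Real.log T ^ 2) = Real.log T - 2 * Real.log (Real.log T) := by
    rw [Real.log_div hT0.ne' (by positivity), Real.log_pow]
    ring
  -- the one-sided statement for `a ≤ b`
  have key : ∀ a b : ℝ, T / Real.log T ^ 2 ≤ a → a ≤ b → b ≤ T →
      |b * Real.log b - a * Real.log a - Real.log T * (b - a)| ≤
        (2 * Real.log (Real.log T) + 1) * |b - a| := by
    intro a b ha hab hbT
    have ha0 : 0 < a := hT'.trans_le ha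
    have hb0 : 0 < b := ha0.trans_le hab
    have hlogb_le : Real.log b ≤ Real.log T := Real.log_le_log hb0 hbT
    have hlogb_ge : Real.log T - 2 * Real.log (Real.log T) ≤ Real.log b := by
      rw [← hlogT']
      exact Real.log_le_log hT' (ha.trans hab)
    have hdiff : b * Real.log b - a * Real.log a =
        (b - a) * Real.log b + a * (Real.log b - Real.log a) := by ring
    have h1 : 0 ≤ a * (Real.log b - Real.log a) :=
      mul_nonneg ha0.le (sub_nonneg.2 (Real.log_le_log ha0 hab))
    have h2 : a * (Real.log b - Real.log a) ≤ b - a := by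
      have := Real.log_le_sub_one_of_pos (show 0 < b / a by positivity)
      rw [Real.log_div hb0.ne' ha0.ne'] at this
      calc a * (Real.log b - Real.log a) ≤ a * (b / a - 1) := mul_le_mul_of_nonneg_left this ha0.le
        _ = b - a := by field_simp
    rw [abs_of_nonneg (sub_nonneg.2 hab), abs_le]
    constructor <;> nlinarith [sub_nonneg.2 hab]
  rcases le_total a b with hab | hab
  · exact key a b ha hab hbT
  · have h := key b a hb hab haT
    calc |b * Real.log b - a * Real.log a - Real.log T * (b - a)|
        = |a * Real.log a - b * Real.log b - Real.log T * (a - b)| := by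
          rw [← abs_neg]; congr 1; ring
      _ ≤ (2 * Real.log (Real.log T) + 1) * |a - b| := h
      _ = (2 * Real.log (Real.log T) + 1) * |b - a| := by rw [abs_sub_comm]

/-- The same in the variables of the pair sums: for `T/L² ≤ γ, γ' ≤ T`,
`|(γ̃ − γ̃') − (L/2π)(γ − γ')| ≤ τ · |(L/2π)(γ − γ')|`, `τ = (2 log L + 1)/L`. [cite: RudnickSarnak1996, (3.71)–(3.77)] -/
theorem abs_renorm_sub_le {T a b : ℝ} (hT : 1 < T) (hL : 0 ≤ Real.log (Real.log T))
    (ha : T / Real.log T ^ 2 ≤ a) (hb : T / Real.log T ^ 2 ≤ b) (haT : a ≤ T) (hbT : b ≤ T) :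
    |(b * Real.log b / (2 * π) - a * Real.log a / (2 * π)) - Real.log T / (2 * π) * (b - a)| ≤
      (2 * Real.log (Real.log T) + 1) / Real.log T * |Real.log T / (2 * π) * (b - a)| := by
  have hLpos : 0 < Real.log T := Real.log_pos hT
  have h := abs_mul_log_sub_mul_log_sub_le hT hL ha hb haT hbT
  have e1 : (b * Real.log b / (2 * π) - a * Real.log a / (2 * π)) - Real.log T / (2 * π) * (b - a) =
      (b * Real.log b - a * Real.log a - Real.log T * (b - a)) / (2 * π) := by ring
  rw [e1, abs_div, abs_of_pos (by positivity : (0 : ℝ) < 2 * π), abs_mul, abs_div,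
    abs_of_pos hLpos, abs_of_pos (by positivity : (0 : ℝ) < 2 * π)]
  rw [div_le_iff₀ (by positivity)]
  calc |b * Real.log b - a * Real.log a - Real.log T * (b - a)|
      ≤ (2 * Real.log (Real.log T) + 1) * |b - a| := h
    _ = (2 * Real.log (Real.log T) + 1) / Real.log T * (Real.log T / (2 * π) * |b - a|) * (2 * π) := by
        field_simp

/-- Decay bookkeeping: `y² (1 + |y|)^{-6} ≤ (1 + |y|)^{-2}`. [folklore] -/
theorem sq_mul_inv_pow_six_le (y : ℝ) : y ^ 2 * ((1 + |y|) ^ 6)⁻¹ ≤ ((1 + |y|) ^ 2)⁻¹ := by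
  have hA : 1 ≤ 1 + |y| := by linarith [abs_nonneg y]
  have hA0 : 0 < 1 + |y| := by linarith
  have h1 : y ^ 2 ≤ (1 + |y|) ^ 2 := by nlinarith [abs_nonneg y, sq_abs y]
  have h2 : (1 + |y|) ^ 2 ≤ (1 + |y|) ^ 4 := by
    calc (1 + |y|) ^ 2 = (1 + |y|) ^ 2 * 1 := (mul_one _).symm
      _ ≤ (1 + |y|) ^ 2 * (1 + |y|) ^ 2 := by gcongr; nlinarith
      _ = (1 + |y|) ^ 4 := by ring
  have e : ((1 + |y|) ^ 2)⁻¹ * (1 + |y|) ^ 6 = (1 + |y|) ^ 4 := by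
    field_simp
  rw [← div_eq_mul_inv, div_le_iff₀ (by positivity), e]
  exact h1.trans h2

/-- Decay bookkeeping: `(1 + |y|)^{-6} ≤ (1 + |y|)^{-2}`. [folklore] -/
theorem inv_pow_six_le_inv_sq (y : ℝ) : ((1 + |y|) ^ 6)⁻¹ ≤ ((1 + |y|) ^ 2)⁻¹ := by
  have hA : 1 ≤ 1 + |y| := by linarith [abs_nonneg y]
  exact inv_anti₀ (by positivity) (pow_le_pow_right₀ hA (by norm_num))

/-- Decay bookkeeping: if `|y|/2 ≤ |z|` then `(1 + |z|)^{-6} ≤ 64 (1 + |y|)^{-6}`. [folklore] -/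
theorem inv_pow_six_le_of_half_le {y z : ℝ} (h : |y| / 2 ≤ |z|) :
    ((1 + |z|) ^ 6)⁻¹ ≤ 64 * ((1 + |y|) ^ 6)⁻¹ := by
  have hz : (1 + |y|) / 2 ≤ 1 + |z| := by linarith [abs_nonneg y]
  have h0 : 0 < (1 + |y|) / 2 := by linarith [abs_nonneg y]
  calc ((1 + |z|) ^ 6)⁻¹ ≤ (((1 + |y|) / 2) ^ 6)⁻¹ :=
        inv_anti₀ (by positivity) (pow_le_pow_left₀ h0.le hz 6)
    _ = 64 * ((1 + |y|) ^ 6)⁻¹ := by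
        rw [div_pow]
        norm_num
        ring

/-- **Pointwise estimate for one pair.** For ordinates `0 < a, b ≤ T` put `L = log T`,
`yM = (L/2π)(b − a)` (Montgomery's variable), `yR = b̃ − ã` (Rudnick–Sarnak's, `t̃ = t log t/2π`),
`τ = (2 log L + 1)/L ≤ 1/2`. If `‖g(y)‖ ≤ C_g (1 + |y|)^{-6}` and `g` is `K`-Lipschitz, then
`‖g(yR) − w(b − a) g(yM)‖` is at most: `π² C_g L^{-2} (1+|yM|)^{-2}` (weight removal,
`1 − w(u) ≤ u²/4 = π² yM²/L²`), plus `C_g((1+|yR|)^{-2} + (1+|yM|)^{-2})` if the pair is low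
(`a` or `b` below `T/L²`), plus `K τ Y` if `|yM| ≤ Y`, plus `65 C_g (1+|yM|)^{-6}` if `|yM| > Y`
(high pairs: `|yR − yM| ≤ τ|yM|`, so `|yR| ≥ |yM|/2`). [cite: RudnickSarnak1996, (3.71)–(3.77)] -/
theorem norm_sub_weight_mul_le {g : ℝ → ℂ} {C_g K : ℝ} (hCg : 0 ≤ C_g) (hK : 0 ≤ K)
    (hdec : ∀ y, ‖g y‖ ≤ C_g * ((1 + |y|) ^ 6)⁻¹)
    (hlip : ∀ y₁ y₂, ‖g y₁ - g y₂‖ ≤ K * |y₁ - y₂|)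
    {T : ℝ} (hT : 1 < T) (hL : 0 ≤ Real.log (Real.log T))
    {τ : ℝ} (hτdef : τ = (2 * Real.log (Real.log T) + 1) / Real.log T) (hτ : τ ≤ 1 / 2)
    {Y : ℝ} (hY : 0 ≤ Y) {a b : ℝ} (haT : a ≤ T) (hbT : b ≤ T)
    {yM yR : ℝ} (hyM : yM = Real.log T / (2 * π) * (b - a))
    (hyR : yR = b * Real.log b / (2 * π) - a * Real.log a / (2 * π)) :
    ‖g yR - (montgomeryWeight (b - a) : ℂ) * g yM‖ ≤
      π ^ 2 * C_g * (Real.log T ^ 2)⁻¹ * ((1 + |yM|) ^ 2)⁻¹ +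
      (if a < T / Real.log T ^ 2 ∨ b < T / Real.log T ^ 2 then
        C_g * (((1 + |yR|) ^ 2)⁻¹ + ((1 + |yM|) ^ 2)⁻¹) else 0) +
      (if |yM| ≤ Y then K * τ * Y else 0) +
      (if Y < |yM| then 65 * C_g * ((1 + |yM|) ^ 6)⁻¹ else 0) := by
  have hLpos : 0 < Real.log T := Real.log_pos hT
  have hτ0 : 0 ≤ τ := by rw [hτdef]; positivity
  obtain ⟨hw0, hw1⟩ := one_sub_montgomeryWeight_mem (b - a)
  -- split off the weight
  have hsplit : ‖g yR - (montgomeryWeight (b - a) : ℂ) * g yM‖ ≤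
      ‖g yR - g yM‖ + (1 - montgomeryWeight (b - a)) * ‖g yM‖ := by
    have e : g yR - (montgomeryWeight (b - a) : ℂ) * g yM =
        (g yR - g yM) + ((1 - montgomeryWeight (b - a) : ℝ) : ℂ) * g yM := by
      push_cast
      ring
    rw [e]
    refine (norm_add_le _ _).trans (le_of_eq ?_)
    rw [norm_mul, Complex.norm_real, Real.norm_of_nonneg hw0]
  -- Term I
  have hI : (1 - montgomeryWeight (b - a)) * ‖g yM‖ ≤
      π ^ 2 * C_g * (Real.log T ^ 2)⁻¹ * ((1 + |yM|) ^ 2)⁻¹ := by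
    have hba : b - a = 2 * π / Real.log T * yM := by
      rw [hyM]
      field_simp
    have h1 : (1 - montgomeryWeight (b - a)) ≤ π ^ 2 * (Real.log T ^ 2)⁻¹ * yM ^ 2 := by
      refine hw1.trans (le_of_eq ?_)
      rw [hba]
      field_simp
      ring
    calc (1 - montgomeryWeight (b - a)) * ‖g yM‖
        ≤ (π ^ 2 * (Real.log T ^ 2)⁻¹ * yM ^ 2) * (C_g * ((1 + |yM|) ^ 6)⁻¹) :=
          mul_le_mul h1 (hdec yM) (norm_nonneg _) (by positivity)
      _ = π ^ 2 * C_g * (Real.log T ^ 2)⁻¹ * (yM ^ 2 * ((1 + |yM|) ^ 6)⁻¹) := by ring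
      _ ≤ π ^ 2 * C_g * (Real.log T ^ 2)⁻¹ * ((1 + |yM|) ^ 2)⁻¹ :=
          mul_le_mul_of_nonneg_left (sq_mul_inv_pow_six_le yM) (by positivity)
  -- nonnegativity of the optional terms
  have ht2 : 0 ≤ (if a < T / Real.log T ^ 2 ∨ b < T / Real.log T ^ 2 then
      C_g * (((1 + |yR|) ^ 2)⁻¹ + ((1 + |yM|) ^ 2)⁻¹) else 0) := by
    split_ifs <;> positivity
  have ht3 : 0 ≤ (if |yM| ≤ Y then K * τ * Y else 0) := by split_ifs <;> positivity
  have ht4 : 0 ≤ (if Y < |yM| then 65 * C_g * ((1 + |yM|) ^ 6)⁻¹ else 0) := by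
    split_ifs <;> positivity
  -- the crude bound `‖g yR − g yM‖ ≤ C_g((1+|yR|)^{-6} + (1+|yM|)^{-6})`
  have hcrude : ‖g yR - g yM‖ ≤ C_g * ((1 + |yR|) ^ 6)⁻¹ + C_g * ((1 + |yM|) ^ 6)⁻¹ :=
    (norm_sub_le _ _).trans (add_le_add (hdec yR) (hdec yM))
  refine hsplit.trans ?_
  by_cases hlow : a < T / Real.log T ^ 2 ∨ b < T / Real.log T ^ 2
  · -- low pair
    rw [if_pos hlow]
    have : ‖g yR - g yM‖ ≤ C_g * (((1 + |yR|) ^ 2)⁻¹ + ((1 + |yM|) ^ 2)⁻¹) := by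
      refine hcrude.trans ?_
      rw [mul_add]
      exact add_le_add (mul_le_mul_of_nonneg_left (inv_pow_six_le_inv_sq yR) hCg)
        (mul_le_mul_of_nonneg_left (inv_pow_six_le_inv_sq yM) hCg)
    linarith
  · -- high pair
    rw [if_neg hlow]
    push Not at hlow
    have hren : |yR - yM| ≤ τ * |yM| := by
      rw [hyR, hyM, hτdef]
      exact abs_renorm_sub_le hT hL hlow.1 hlow.2 haT hbT
    by_cases hnear : |yM| ≤ Y
    · rw [if_pos hnear]
      have : ‖g yR - g yM‖ ≤ K * τ * Y := by
        calc ‖g yR - g yM‖ ≤ K * |yR - yM| := hlip yR yM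
          _ ≤ K * (τ * |yM|) := mul_le_mul_of_nonneg_left hren hK
          _ ≤ K * (τ * Y) := by gcongr
          _ = K * τ * Y := by ring
      linarith
    · rw [if_neg hnear, if_pos (not_le.1 hnear)]
      have hhalf : |yM| / 2 ≤ |yR| := by
        have := abs_sub_abs_le_abs_sub yM yR
        rw [abs_sub_comm] at this
        nlinarith [abs_nonneg yM]
      have : ‖g yR - g yM‖ ≤ 65 * C_g * ((1 + |yM|) ^ 6)⁻¹ := by
        calc ‖g yR - g yM‖ ≤ C_g * ((1 + |yR|) ^ 6)⁻¹ + C_g * ((1 + |yM|) ^ 6)⁻¹ := hcrude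
          _ ≤ C_g * (64 * ((1 + |yM|) ^ 6)⁻¹) + C_g * ((1 + |yM|) ^ 6)⁻¹ := by
              gcongr
              exact inv_pow_six_le_of_half_le hhalf
          _ = 65 * C_g * ((1 + |yM|) ^ 6)⁻¹ := by ring
      linarith

/-- Decay bookkeeping: for `√L ≤ |y|` (`0 ≤ L`), `(1 + |y|)^{-6} ≤ L^{-2} (1 + |y|)^{-2}`. [folklore] -/
theorem inv_pow_six_le_of_sqrt_le {L y : ℝ} (hL : 0 < L) (h : Real.sqrt L ≤ |y|) :
    ((1 + |y|) ^ 6)⁻¹ ≤ (L ^ 2)⁻¹ * ((1 + |y|) ^ 2)⁻¹ := by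
  have hs : Real.sqrt L ^ 2 = L := Real.sq_sqrt hL.le
  have hy1 : L ≤ |y| ^ 2 := by
    rw [← hs]
    exact pow_le_pow_left₀ (Real.sqrt_nonneg L) h 2
  have hy2 : L ^ 2 ≤ (1 + |y|) ^ 4 := by
    calc L ^ 2 ≤ (|y| ^ 2) ^ 2 := pow_le_pow_left₀ hL.le hy1 2
      _ = |y| ^ 4 := by ring
      _ ≤ (1 + |y|) ^ 4 := pow_le_pow_left₀ (abs_nonneg y) (by linarith [abs_nonneg y]) 4
  rw [← mul_inv, inv_le_inv₀ (by positivity) (by positivity)]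
  calc L ^ 2 * (1 + |y|) ^ 2 ≤ (1 + |y|) ^ 4 * (1 + |y|) ^ 2 := by gcongr
    _ = (1 + |y|) ^ 6 := by ring

/-- Sums over a union, non-negative summands. [folklore] -/
theorem sum_union_le_add {ι : Type*} [DecidableEq ι] (A B : Finset ι) {f : ι → ℝ}
    (hf : ∀ i, 0 ≤ f i) : ∑ i ∈ A ∪ B, f i ≤ ∑ i ∈ A, f i + ∑ i ∈ B, f i := by
  rw [← Finset.sum_union_inter]
  have : 0 ≤ ∑ i ∈ A ∩ B, f i := Finset.sum_nonneg fun i _ ↦ hf i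
  linarith

/-- **The master estimate at height `T`** (deterministic form of RS (3.71)–(3.77) at `n = 2`,
with Montgomery's weight removed at the same time): summing `norm_sub_weight_mul_le` over all
pairs of indices `< N(T)`, with the window bound `M` at scale `1/log T`
(`exists_pairCount_window_le`) and the unit-window bound `M₁` in both variables, the four terms
are controlled by the shell lemma `sum_inv_one_add_abs_sub_sq_le` (`∑_j (1+|y_{ij}|)^{-2} ≤ 6M₁`),
the low set `{c : γ_c < T/L²}`, `card_filter_abs_le_le` and `sum_filter_mid_le`.
[cite: RudnickSarnak1996, (3.71)–(3.77)] -/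
theorem sum_norm_sub_weight_mul_le {g : ℝ → ℂ} {C_g K : ℝ} (hCg : 0 ≤ C_g) (hK : 0 ≤ K)
    (hdec : ∀ y, ‖g y‖ ≤ C_g * ((1 + |y|) ^ 6)⁻¹)
    (hlip : ∀ y₁ y₂, ‖g y₁ - g y₂‖ ≤ K * |y₁ - y₂|)
    {T : ℝ} (hT : 1 < T) (hL : 0 ≤ Real.log (Real.log T))
    {τ : ℝ} (hτdef : τ = (2 * Real.log (Real.log T) + 1) / Real.log T) (hτ : τ ≤ 1 / 2)
    {y₀ Y M M₁ : ℝ} (hy₀ : 0 < y₀) (hY : 3 * y₀ ≤ Y) (hM : 0 ≤ M)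
    (hYL : Y ≤ Real.sqrt (Real.log T))
    (hR : (Real.sqrt (Real.log T) / y₀ + 5 / 2) * y₀ ≤ Real.log T / π)
    (hwin : ∀ s : ℝ, |s| + y₀ ≤ Real.log T / π →
      (((zeroIndexSet T ×ˢ zeroIndexSet T).filter fun p ↦
        |Real.log T / (2 * π) * (zetaOrdinate p.1 - zetaOrdinate p.2) - s| ≤ y₀).card : ℝ) ≤ M)
    (hM₁a : ∀ v : ℝ, (((zeroIndexSet T).filter fun c ↦
        v ≤ Real.log T / (2 * π) * zetaOrdinate c ∧
          Real.log T / (2 * π) * zetaOrdinate c ≤ v + 1).card : ℝ) ≤ M₁)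
    (hM₁b : ∀ v : ℝ, (((zeroIndexSet T).filter fun c ↦
        v ≤ normalizedOrdinate c ∧ normalizedOrdinate c ≤ v + 1).card : ℝ) ≤ M₁) :
    ∑ p ∈ zeroIndexSet T ×ˢ zeroIndexSet T,
        ‖g (normalizedOrdinate p.1 - normalizedOrdinate p.2) -
          (montgomeryWeight (zetaOrdinate p.1 - zetaOrdinate p.2) : ℂ) *
            g (Real.log T / (2 * π) * (zetaOrdinate p.1 - zetaOrdinate p.2))‖ ≤
      π ^ 2 * C_g * (Real.log T ^ 2)⁻¹ * (zetaZeroCount T * (6 * M₁)) +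
      C_g * (2 * (((zeroIndexSet T).filter fun c ↦
        zetaOrdinate c < T / Real.log T ^ 2).card * (12 * M₁))) +
      K * τ * Y * (2 * M * (⌊Y / y₀⌋₊ + 1)) +
      65 * C_g * (2 * M / (y₀ * (Y - 2 * y₀)) + (Real.log T ^ 2)⁻¹ * (zetaZeroCount T * (6 * M₁))) := by
  classical
  have hLpos : 0 < Real.log T := Real.log_pos hT
  have hY0 : 0 ≤ Y := by linarith
  have hτ0 : 0 ≤ τ := by rw [hτdef]; positivity
  have hRvM := riemann_von_mangoldt_holds
  set Z := zeroIndexSet T with hZ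
  set c : ℝ := Real.log T / (2 * π) with hc
  set yM : ℕ × ℕ → ℝ := fun p ↦ c * (zetaOrdinate p.1 - zetaOrdinate p.2) with hyM
  set yR : ℕ × ℕ → ℝ := fun p ↦ normalizedOrdinate p.1 - normalizedOrdinate p.2 with hyR
  set T' : ℝ := T / Real.log T ^ 2 with hT'
  -- ordinates of indices in `Z` are in `(0, T]`
  have hγT : ∀ n ∈ Z, zetaOrdinate n ≤ T := fun n hn ↦
    hRvM.zetaOrdinate_le_iff.2 (Finset.mem_range.1 hn)
  -- unit-window (shell) sums in both variables
  have hM₁0 : 0 ≤ M₁ := le_trans (Nat.cast_nonneg _) (hM₁a 0)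
  have hshellM : ∀ x : ℝ, ∑ j ∈ Z, ((1 + |c * zetaOrdinate j - x|) ^ 2)⁻¹ ≤ 6 * M₁ :=
    sum_inv_one_add_abs_sub_sq_le Z (fun j ↦ c * zetaOrdinate j) hM₁a
  have hshellR : ∀ x : ℝ, ∑ j ∈ Z, ((1 + |normalizedOrdinate j - x|) ^ 2)⁻¹ ≤ 6 * M₁ :=
    sum_inv_one_add_abs_sub_sq_le Z normalizedOrdinate hM₁b
  -- `Σ₁ := ∑_p (1+|yM p|)^{-2} ≤ N · 6M₁`
  have hSig1 : ∑ p ∈ Z ×ˢ Z, ((1 + |yM p|) ^ 2)⁻¹ ≤ zetaZeroCount T * (6 * M₁) := by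
    rw [Finset.sum_product]
    calc ∑ i ∈ Z, ∑ j ∈ Z, ((1 + |yM (i, j)|) ^ 2)⁻¹ ≤ ∑ i ∈ Z, 6 * M₁ := by
          refine Finset.sum_le_sum fun i _ ↦ ?_
          have h := hshellM (c * zetaOrdinate i)
          refine le_trans (le_of_eq (Finset.sum_congr rfl fun j _ ↦ ?_)) h
          simp only [hyM, mul_sub, abs_sub_comm]
      _ = zetaZeroCount T * (6 * M₁) := by
          rw [Finset.sum_const, nsmul_eq_mul, hZ, card_zeroIndexSet]
  -- pointwise bound
  have hpt : ∀ p ∈ Z ×ˢ Z,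
      ‖g (yR p) - (montgomeryWeight (zetaOrdinate p.1 - zetaOrdinate p.2) : ℂ) * g (yM p)‖ ≤
        π ^ 2 * C_g * (Real.log T ^ 2)⁻¹ * ((1 + |yM p|) ^ 2)⁻¹ +
        (if zetaOrdinate p.2 < T' ∨ zetaOrdinate p.1 < T' then
          C_g * (((1 + |yR p|) ^ 2)⁻¹ + ((1 + |yM p|) ^ 2)⁻¹) else 0) +
        (if |yM p| ≤ Y then K * τ * Y else 0) +
        (if Y < |yM p| then 65 * C_g * ((1 + |yM p|) ^ 6)⁻¹ else 0) := by
    intro p hp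
    rw [Finset.mem_product] at hp
    refine norm_sub_weight_mul_le hCg hK hdec hlip hT hL hτdef hτ hY0 (hγT _ hp.2) (hγT _ hp.1)
      (by simp [hyM, hc]) ?_
    simp [hyR, normalizedOrdinate]
  -- sum the pointwise bound
  have hsum := Finset.sum_le_sum hpt
  rw [Finset.sum_add_distrib, Finset.sum_add_distrib, Finset.sum_add_distrib] at hsum
  refine le_trans (le_of_eq (Finset.sum_congr rfl fun p _ ↦ by simp [hyR, hyM, hc])) (hsum.trans ?_)
  gcongr ?_ + ?_ + ?_ + ?_
  · -- Term I
    rw [← Finset.mul_sum]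
    exact mul_le_mul_of_nonneg_left hSig1 (by positivity)
  · -- low pairs
    rw [← Finset.sum_filter, ← Finset.mul_sum]
    refine mul_le_mul_of_nonneg_left ?_ hCg
    set Ilow := Z.filter fun n ↦ zetaOrdinate n < T' with hIlow
    have hnn : ∀ p : ℕ × ℕ, 0 ≤ ((1 + |yR p|) ^ 2)⁻¹ + ((1 + |yM p|) ^ 2)⁻¹ := fun p ↦ by positivity
    have hsub : ((Z ×ˢ Z).filter fun p ↦ zetaOrdinate p.2 < T' ∨ zetaOrdinate p.1 < T') ⊆
        Ilow ×ˢ Z ∪ Z ×ˢ Ilow := by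
      intro p hp
      rw [Finset.mem_filter, Finset.mem_product] at hp
      rw [Finset.mem_union, Finset.mem_product, Finset.mem_product, hIlow, Finset.mem_filter,
        Finset.mem_filter]
      rcases hp.2 with h | h
      · exact Or.inr ⟨hp.1.1, hp.1.2, h⟩
      · exact Or.inl ⟨⟨hp.1.1, h⟩, hp.1.2⟩
    have hrow : ∀ i : ℕ, ∑ j ∈ Z, (((1 + |yR (i, j)|) ^ 2)⁻¹ + ((1 + |yM (i, j)|) ^ 2)⁻¹) ≤ 12 * M₁ := by
      intro i
      rw [Finset.sum_add_distrib]
      have h1 := hshellR (normalizedOrdinate i)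
      have h2 := hshellM (c * zetaOrdinate i)
      have e1 : ∑ j ∈ Z, ((1 + |yR (i, j)|) ^ 2)⁻¹ = ∑ j ∈ Z, ((1 + |normalizedOrdinate j - normalizedOrdinate i|) ^ 2)⁻¹ :=
        Finset.sum_congr rfl fun j _ ↦ by simp only [hyR, abs_sub_comm]
      have e2 : ∑ j ∈ Z, ((1 + |yM (i, j)|) ^ 2)⁻¹ = ∑ j ∈ Z, ((1 + |c * zetaOrdinate j - c * zetaOrdinate i|) ^ 2)⁻¹ :=
        Finset.sum_congr rfl fun j _ ↦ by simp only [hyM, mul_sub, abs_sub_comm]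
      rw [e1, e2]
      linarith
    have hcol : ∀ j : ℕ, ∑ i ∈ Z, (((1 + |yR (i, j)|) ^ 2)⁻¹ + ((1 + |yM (i, j)|) ^ 2)⁻¹) ≤ 12 * M₁ := by
      intro j
      rw [Finset.sum_add_distrib]
      have h1 := hshellR (normalizedOrdinate j)
      have h2 := hshellM (c * zetaOrdinate j)
      have e2 : ∑ i ∈ Z, ((1 + |yM (i, j)|) ^ 2)⁻¹ = ∑ i ∈ Z, ((1 + |c * zetaOrdinate i - c * zetaOrdinate j|) ^ 2)⁻¹ :=
        Finset.sum_congr rfl fun i _ ↦ by simp only [hyM, mul_sub]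
      rw [e2]
      simp only [hyR] at h1 ⊢
      linarith
    calc ∑ p ∈ (Z ×ˢ Z).filter (fun p ↦ zetaOrdinate p.2 < T' ∨ zetaOrdinate p.1 < T'),
          (((1 + |yR p|) ^ 2)⁻¹ + ((1 + |yM p|) ^ 2)⁻¹)
        ≤ ∑ p ∈ Ilow ×ˢ Z ∪ Z ×ˢ Ilow, (((1 + |yR p|) ^ 2)⁻¹ + ((1 + |yM p|) ^ 2)⁻¹) :=
          Finset.sum_le_sum_of_subset_of_nonneg hsub fun p _ _ ↦ hnn p
      _ ≤ ∑ p ∈ Ilow ×ˢ Z, (((1 + |yR p|) ^ 2)⁻¹ + ((1 + |yM p|) ^ 2)⁻¹) +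
          ∑ p ∈ Z ×ˢ Ilow, (((1 + |yR p|) ^ 2)⁻¹ + ((1 + |yM p|) ^ 2)⁻¹) :=
          sum_union_le_add _ _ hnn
      _ ≤ Ilow.card * (12 * M₁) + Ilow.card * (12 * M₁) := by
          gcongr
          · rw [Finset.sum_product]
            calc ∑ i ∈ Ilow, ∑ j ∈ Z, (((1 + |yR (i, j)|) ^ 2)⁻¹ + ((1 + |yM (i, j)|) ^ 2)⁻¹)
                ≤ ∑ i ∈ Ilow, 12 * M₁ := Finset.sum_le_sum fun i _ ↦ hrow i
              _ = Ilow.card * (12 * M₁) := by rw [Finset.sum_const, nsmul_eq_mul]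
          · rw [Finset.sum_product_right]
            calc ∑ j ∈ Ilow, ∑ i ∈ Z, (((1 + |yR (i, j)|) ^ 2)⁻¹ + ((1 + |yM (i, j)|) ^ 2)⁻¹)
                ≤ ∑ j ∈ Ilow, 12 * M₁ := Finset.sum_le_sum fun j _ ↦ hcol j
              _ = Ilow.card * (12 * M₁) := by rw [Finset.sum_const, nsmul_eq_mul]
      _ = 2 * (Ilow.card * (12 * M₁)) := by ring
  · -- near pairs
    rw [← Finset.sum_filter, Finset.sum_const, nsmul_eq_mul, mul_comm]
    refine mul_le_mul_of_nonneg_left ?_ (by positivity)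
    have hR' : (Y / y₀ + 5 / 2) * y₀ ≤ Real.log T / π := by
      refine le_trans ?_ hR
      gcongr
    exact card_filter_abs_le_le (Z ×ˢ Z) yM hy₀ hY0 hwin hR'
  · -- far pairs
    rw [← Finset.sum_filter, ← Finset.mul_sum]
    refine mul_le_mul_of_nonneg_left ?_ (by positivity)
    rw [← Finset.sum_filter_add_sum_filter_not _ (fun p ↦ |yM p| ≤ Real.sqrt (Real.log T))]
    gcongr ?_ + ?_
    · rw [Finset.filter_filter]
      calc ∑ p ∈ (Z ×ˢ Z).filter (fun p ↦ Y < |yM p| ∧ |yM p| ≤ Real.sqrt (Real.log T)),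
            ((1 + |yM p|) ^ 6)⁻¹
          ≤ ∑ p ∈ (Z ×ˢ Z).filter (fun p ↦ Y < |yM p| ∧ |yM p| ≤ Real.sqrt (Real.log T)),
            ((1 + |yM p|) ^ 2)⁻¹ := Finset.sum_le_sum fun p _ ↦ inv_pow_six_le_inv_sq _
        _ ≤ 2 * M / (y₀ * (Y - 2 * y₀)) := sum_filter_mid_le (Z ×ˢ Z) yM hy₀ hY hM hwin hR
    · calc ∑ p ∈ ((Z ×ˢ Z).filter fun p ↦ Y < |yM p|) with ¬ |yM p| ≤ Real.sqrt (Real.log T),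
            ((1 + |yM p|) ^ 6)⁻¹
          ≤ ∑ p ∈ ((Z ×ˢ Z).filter fun p ↦ Y < |yM p|) with ¬ |yM p| ≤ Real.sqrt (Real.log T),
            (Real.log T ^ 2)⁻¹ * ((1 + |yM p|) ^ 2)⁻¹ := by
            refine Finset.sum_le_sum fun p hp ↦ ?_
            rw [Finset.mem_filter] at hp
            exact inv_pow_six_le_of_sqrt_le hLpos (not_le.1 hp.2).le
        _ ≤ ∑ p ∈ Z ×ˢ Z, (Real.log T ^ 2)⁻¹ * ((1 + |yM p|) ^ 2)⁻¹ := by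
            refine Finset.sum_le_sum_of_subset_of_nonneg ?_ fun p _ _ ↦ by positivity
            exact (Finset.filter_subset _ _).trans (Finset.filter_subset _ _)
        _ = (Real.log T ^ 2)⁻¹ * ∑ p ∈ Z ×ˢ Z, ((1 + |yM p|) ^ 2)⁻¹ := by rw [Finset.mul_sum]
        _ ≤ (Real.log T ^ 2)⁻¹ * (zetaZeroCount T * (6 * M₁)) :=
            mul_le_mul_of_nonneg_left hSig1 (by positivity)

/-- `T / (log T)² → ∞`. [folklore] -/
theorem tendsto_div_log_sq_atTop : Tendsto (fun T : ℝ ↦ T / Real.log T ^ 2) atTop atTop := by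
  have h0 : Tendsto (fun T : ℝ ↦ Real.log T ^ 2 / T) atTop (𝓝 0) := by
    have h := Real.tendsto_pow_log_div_mul_add_atTop 1 0 2 one_ne_zero
    simpa using h
  have hpos : ∀ᶠ T : ℝ in atTop, 0 < Real.log T ^ 2 / T := by
    filter_upwards [eventually_gt_atTop (1 : ℝ)] with T hT
    exact div_pos (pow_pos (Real.log_pos hT) 2) (by linarith)
  have h1 : Tendsto (fun T : ℝ ↦ Real.log T ^ 2 / T) atTop (𝓝[>] 0) :=
    tendsto_nhdsWithin_iff.2 ⟨h0, hpos⟩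
  have h2 := tendsto_inv_nhdsGT_zero.comp h1
  refine h2.congr fun T ↦ ?_
  simp [inv_div]

/-- `τ(T) = (2 log log T + 1)/log T → 0`. [folklore] -/
theorem tendsto_tau_zero :
    Tendsto (fun T : ℝ ↦ (2 * Real.log (Real.log T) + 1) / Real.log T) atTop (𝓝 0) := by
  have h1 : Tendsto (fun u : ℝ ↦ (2 * Real.log u + 1) / u) atTop (𝓝 0) := by
    have ha := Real.tendsto_pow_log_div_mul_add_atTop 1 0 1 one_ne_zero
    have hb : Tendsto (fun u : ℝ ↦ u⁻¹) atTop (𝓝 0) := tendsto_inv_atTop_zero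
    have := (ha.const_mul 2).add hb
    simp only [mul_zero, zero_add] at this
    refine this.congr' ?_
    filter_upwards [eventually_gt_atTop (0 : ℝ)] with u hu
    simp only [pow_one, one_mul, add_zero]
    field_simp
  exact h1.comp Real.tendsto_log_atTop

/-- The final arithmetic of `eventually_sum_norm_sub_weight_mul_le`: with `M = C T L`,
`M₁ = C₂ L`, `T L ≤ 4π N`, `#low ≤ C_N T/L`, the master bound is `≤ ε N` once
`A/L + B_c τ < ε/2` and the `Y`-term is `≤ ε/6`. [folklore] -/
theorem master_bound_le_eps_mul {C_g K C C₂ C_N y₀ Y ε L T N I τ fl : ℝ}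
    (hCg : 0 ≤ C_g) (hK : 0 ≤ K) (hC : 0 < C) (hC₂ : 0 < C₂) (hC_N : 0 < C_N) (hy₀ : 0 < y₀)
    (hε : 0 < ε) (hL : 0 < L) (hT : 0 < T) (hN : 0 < N) (hτ0 : 0 ≤ τ) (hY0 : 0 ≤ Y)
    (hden0 : 0 < Y - 2 * y₀) (hfl0 : 0 ≤ fl) (hfloor : fl ≤ Y / y₀)
    (hTL : T * L ≤ 4 * π * N) (hI : I ≤ C_N * (T / L))
    (hYfar : 520 * π * C_g * C / (y₀ * (Y - 2 * y₀)) ≤ ε / 6)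
    (hΦ : (6 * π ^ 2 * C_g * C₂ + 96 * π * C_g * C₂ * C_N + 390 * C_g * C₂) * L⁻¹ +
      (8 * π * K * C * Y * (Y / y₀ + 1)) * τ < ε / 2) :
    π ^ 2 * C_g * (L ^ 2)⁻¹ * (N * (6 * (C₂ * L))) +
      C_g * (2 * (I * (12 * (C₂ * L)))) +
      K * τ * Y * (2 * (C * (T * L)) * (fl + 1)) +
      65 * C_g * (2 * (C * (T * L)) / (y₀ * (Y - 2 * y₀)) + (L ^ 2)⁻¹ * (N * (6 * (C₂ * L)))) ≤
      ε * N := by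
  have h1 : π ^ 2 * C_g * (L ^ 2)⁻¹ * (N * (6 * (C₂ * L))) = (6 * π ^ 2 * C_g * C₂) * L⁻¹ * N := by
    field_simp
  have h2 : C_g * (2 * (I * (12 * (C₂ * L)))) ≤ (96 * π * C_g * C₂ * C_N) * L⁻¹ * N := by
    calc C_g * (2 * (I * (12 * (C₂ * L)))) ≤ C_g * (2 * (C_N * (T / L) * (12 * (C₂ * L)))) := by
          gcongr
      _ = 24 * C_g * C₂ * C_N * (T * L) * L⁻¹ := by field_simp; ring
      _ ≤ 24 * C_g * C₂ * C_N * (4 * π * N) * L⁻¹ := by gcongr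
      _ = (96 * π * C_g * C₂ * C_N) * L⁻¹ * N := by ring
  have h3 : K * τ * Y * (2 * (C * (T * L)) * (fl + 1)) ≤ (8 * π * K * C * Y * (Y / y₀ + 1)) * τ * N := by
    calc K * τ * Y * (2 * (C * (T * L)) * (fl + 1))
        ≤ K * τ * Y * (2 * (C * (4 * π * N)) * (Y / y₀ + 1)) := by gcongr
      _ = (8 * π * K * C * Y * (Y / y₀ + 1)) * τ * N := by ring
  have h4 : 65 * C_g * (2 * (C * (T * L)) / (y₀ * (Y - 2 * y₀)) + (L ^ 2)⁻¹ * (N * (6 * (C₂ * L)))) ≤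
      ε / 6 * N + (390 * C_g * C₂) * L⁻¹ * N := by
    have ha : 65 * C_g * (2 * (C * (T * L)) / (y₀ * (Y - 2 * y₀))) ≤ ε / 6 * N := by
      calc 65 * C_g * (2 * (C * (T * L)) / (y₀ * (Y - 2 * y₀)))
          ≤ 65 * C_g * (2 * (C * (4 * π * N)) / (y₀ * (Y - 2 * y₀))) := by gcongr
        _ = 520 * π * C_g * C / (y₀ * (Y - 2 * y₀)) * N := by
            field_simp
            ring
        _ ≤ ε / 6 * N := mul_le_mul_of_nonneg_right hYfar hN.le
    have hb : 65 * C_g * ((L ^ 2)⁻¹ * (N * (6 * (C₂ * L)))) = (390 * C_g * C₂) * L⁻¹ * N := by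
      field_simp
      ring
    rw [mul_add, hb]
    linarith
  have hfin : ((6 * π ^ 2 * C_g * C₂ + 96 * π * C_g * C₂ * C_N + 390 * C_g * C₂) * L⁻¹ +
      (8 * π * K * C * Y * (Y / y₀ + 1)) * τ) * N ≤ ε / 2 * N :=
    mul_le_mul_of_nonneg_right hΦ.le hN.le
  rw [h1]
  nlinarith [h2, h3, h4, hfin]

/-- **Weight removal and renormalisation are negligible** (RS (3.71)–(3.77) at `n = 2`, plus
`w → 1`): assuming RH, for `g` with `‖g(y)‖ ≤ C_g (1+|y|)^{-6}` and `K`-Lipschitz, for every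
`ε > 0` and all large `T`,
`∑_{i,j < N(T)} ‖g(γ̃_i − γ̃_j) − w(γ_i − γ_j) g(L(γ_i − γ_j)/2π)‖ ≤ ε N(T)`.
From the master estimate `sum_norm_sub_weight_mul_le` with `M = C T log T`
(`exists_pairCount_window_le`), `M₁ ≍ log T` (unit windows in both variables), the low set of
size `≤ N(T/L²) ≪ T/L`, `N(T) ≫ T log T`, `τ(T) → 0`, and `Y = Y(ε)`.
[cite: RudnickSarnak1996, (3.71)–(3.77)] -/
theorem eventually_sum_norm_sub_weight_mul_le (hRH : RiemannHypothesis) {g : ℝ → ℂ} {C_g K : ℝ}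
    (hCg : 0 ≤ C_g) (hK : 0 ≤ K)
    (hdec : ∀ y, ‖g y‖ ≤ C_g * ((1 + |y|) ^ 6)⁻¹)
    (hlip : ∀ y₁ y₂, ‖g y₁ - g y₂‖ ≤ K * |y₁ - y₂|) {ε : ℝ} (hε : 0 < ε) :
    ∀ᶠ T : ℝ in atTop, ∑ p ∈ zeroIndexSet T ×ˢ zeroIndexSet T,
        ‖g (normalizedOrdinate p.1 - normalizedOrdinate p.2) -
          (montgomeryWeight (zetaOrdinate p.1 - zetaOrdinate p.2) : ℂ) *
            g (Real.log T / (2 * π) * (zetaOrdinate p.1 - zetaOrdinate p.2))‖ ≤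
      ε * zetaZeroCount T := by
  -- constants
  obtain ⟨y₀, hy₀, Cst, hwinE⟩ := exists_pairCount_window_le hRH
  obtain ⟨C₁, hC₁, hunitE⟩ := eventually_card_filter_zetaOrdinate_window_le
  obtain ⟨Cw, hCw, T₁, hwinγ⟩ := exists_zetaZeroCount_window_le
  obtain ⟨C_N, hC_N, hNle⟩ := riemann_von_mangoldt_holds.eventually_le_mul
  set C : ℝ := max Cst 1 with hCdef
  have hC0 : 0 < C := lt_max_of_lt_right one_pos
  set C₂ : ℝ := max C₁ Cw with hC₂def
  have hC₂0 : 0 < C₂ := lt_max_of_lt_left hC₁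
  -- the cut-off `Y = Y(ε)`
  set Y : ℝ := 3 * y₀ + 1 + 3120 * π * C_g * C / (y₀ * ε) with hYdef
  have hQ0 : 0 ≤ 3120 * π * C_g * C / (y₀ * ε) := by positivity
  have hY3 : 3 * y₀ ≤ Y := by rw [hYdef]; linarith
  have hY0 : 0 ≤ Y := by linarith
  have hden0 : 0 < Y - 2 * y₀ := by linarith
  have hYfar : 520 * π * C_g * C / (y₀ * (Y - 2 * y₀)) ≤ ε / 6 := by
    have hden : 3120 * π * C_g * C / (y₀ * ε) ≤ Y - 2 * y₀ := by rw [hYdef]; linarith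
    rw [div_le_iff₀ (by positivity)]
    have h1 : 3120 * π * C_g * C = 3120 * π * C_g * C / (y₀ * ε) * (y₀ * ε) := by field_simp
    have h2 : 3120 * π * C_g * C / (y₀ * ε) * (y₀ * ε) ≤ (Y - 2 * y₀) * (y₀ * ε) :=
      mul_le_mul_of_nonneg_right hden (by positivity)
    nlinarith
  -- the vanishing part `Φ(T)`
  set A : ℝ := 6 * π ^ 2 * C_g * C₂ + 96 * π * C_g * C₂ * C_N + 390 * C_g * C₂ with hAdef
  set Bc : ℝ := 8 * π * K * C * Y * (Y / y₀ + 1) with hBdef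
  have hΦ : Tendsto (fun T : ℝ ↦ A * (Real.log T)⁻¹ +
      Bc * ((2 * Real.log (Real.log T) + 1) / Real.log T)) atTop (𝓝 0) := by
    have h1 : Tendsto (fun T : ℝ ↦ A * (Real.log T)⁻¹) atTop (𝓝 (A * 0)) :=
      (tendsto_inv_atTop_zero.comp Real.tendsto_log_atTop).const_mul A
    have h2 : Tendsto (fun T : ℝ ↦ Bc * ((2 * Real.log (Real.log T) + 1) / Real.log T)) atTop
        (𝓝 (Bc * 0)) := tendsto_tau_zero.const_mul Bc
    simpa using h1.add h2
  -- events
  have hN : ∀ᶠ T : ℝ in atTop, T * Real.log T / (4 * π) ≤ zetaZeroCount T := by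
    have h := tendsto_zetaZeroCount_div_main.eventually
      (eventually_ge_nhds (show (1 : ℝ) / 2 < 1 by norm_num))
    filter_upwards [h, eventually_gt_atTop (1 : ℝ)] with T hT h1
    have hpos : 0 < T / (2 * π) * Real.log T := by
      have := Real.log_pos h1
      positivity
    rw [le_div_iff₀ hpos] at hT
    calc T * Real.log T / (4 * π) = 1 / 2 * (T / (2 * π) * Real.log T) := by ring
      _ ≤ zetaZeroCount T := hT
  have hlow : ∀ᶠ T : ℝ in atTop, (zetaZeroCount (T / Real.log T ^ 2) : ℝ) ≤
      C_N * (T / Real.log T ^ 2 * Real.log (T / Real.log T ^ 2)) :=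
    tendsto_div_log_sq_atTop.eventually hNle
  have hbig : ∀ᶠ T : ℝ in atTop, Real.exp 1 ≤ Real.log T ∧ 2 * π ≤ Real.log T ∧
      (2 * Real.log (Real.log T) + 1) / Real.log T ≤ 1 / 2 ∧ Y ≤ Real.sqrt (Real.log T) ∧
      (Real.sqrt (Real.log T) / y₀ + 5 / 2) * y₀ ≤ Real.log T / π := by
    have hL := Real.tendsto_log_atTop
    have e1 : ∀ᶠ T : ℝ in atTop, Real.exp 1 ≤ Real.log T := hL.eventually_ge_atTop _
    have e2 : ∀ᶠ T : ℝ in atTop, 2 * π ≤ Real.log T := hL.eventually_ge_atTop _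
    have e3 : ∀ᶠ T : ℝ in atTop, (2 * Real.log (Real.log T) + 1) / Real.log T ≤ 1 / 2 :=
      tendsto_tau_zero.eventually (eventually_le_nhds (by norm_num))
    have hsq : Tendsto (fun T : ℝ ↦ Real.sqrt (Real.log T)) atTop atTop :=
      Real.tendsto_sqrt_atTop.comp hL
    have e4 : ∀ᶠ T : ℝ in atTop, Y ≤ Real.sqrt (Real.log T) := hsq.eventually_ge_atTop Y
    have e5 : ∀ᶠ T : ℝ in atTop,
        (Real.sqrt (Real.log T) / y₀ + 5 / 2) * y₀ ≤ Real.log T / π := by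
      -- `√L (√L/π − 1) → ∞`, and `L/π − √L = √L(√L/π − 1)`
      have h2 : Tendsto (fun T : ℝ ↦ Real.sqrt (Real.log T) * (Real.sqrt (Real.log T) / π - 1))
          atTop atTop :=
        hsq.atTop_mul_atTop₀ (tendsto_atTop_add_const_right _ (-1)
          (hsq.atTop_div_const Real.pi_pos))
      filter_upwards [h2.eventually_ge_atTop (5 / 2 * y₀), eventually_gt_atTop (1 : ℝ)]
        with T hT hT1
      have hs := Real.sq_sqrt (Real.log_pos hT1).le
      have e : Real.sqrt (Real.log T) * (Real.sqrt (Real.log T) / π - 1) =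
          Real.log T / π - Real.sqrt (Real.log T) := by
        rw [mul_sub, mul_one, mul_div_assoc', ← sq, hs]
      rw [e] at hT
      have : (Real.sqrt (Real.log T) / y₀ + 5 / 2) * y₀ =
          Real.sqrt (Real.log T) + 5 / 2 * y₀ := by
        field_simp
      rw [this]
      linarith
    filter_upwards [e1, e2, e3, e4, e5] with T h1 h2 h3 h4 h5
    exact ⟨h1, h2, h3, h4, h5⟩
  have hΦε : ∀ᶠ T : ℝ in atTop, A * (Real.log T)⁻¹ +
      Bc * ((2 * Real.log (Real.log T) + 1) / Real.log T) < ε / 2 :=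
    hΦ.eventually (gt_mem_nhds (by positivity))
  filter_upwards [hwinE, hunitE, eventually_ge_atTop T₁, hN, hlow, hbig, hΦε,
    eventually_gt_atTop (1 : ℝ)] with T hwin hunit hT₁ hNT hlowT hbigT hΦT hT
  obtain ⟨hLe, hL2π, hτ, hYL, hR⟩ := hbigT
  have hLpos : 0 < Real.log T := Real.log_pos hT
  have hL1 : 1 ≤ Real.log T := le_trans (by have := Real.add_one_le_exp (1 : ℝ); linarith) hLe
  have hlogL : 0 ≤ Real.log (Real.log T) := Real.log_nonneg hL1
  have hT0 : 0 < T := by linarith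
  -- the bounds `M`, `M₁`
  set M : ℝ := C * (T * Real.log T) with hMdef
  have hM0 : 0 ≤ M := by positivity
  have hwin' : ∀ s : ℝ, |s| + y₀ ≤ Real.log T / π →
      (((zeroIndexSet T ×ˢ zeroIndexSet T).filter fun p ↦
        |Real.log T / (2 * π) * (zetaOrdinate p.1 - zetaOrdinate p.2) - s| ≤ y₀).card : ℝ) ≤
        M := by
    intro s hs
    refine (hwin s hs).trans ?_
    rw [hMdef]
    exact mul_le_mul_of_nonneg_right (le_max_left _ _) (by positivity)
  set M₁ : ℝ := C₂ * Real.log T with hM₁def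
  have hM₁a : ∀ v : ℝ, (((zeroIndexSet T).filter fun c ↦
      v ≤ Real.log T / (2 * π) * zetaOrdinate c ∧
        Real.log T / (2 * π) * zetaOrdinate c ≤ v + 1).card : ℝ) ≤ M₁ := by
    intro v
    refine (card_filter_scaled_window_le hL2π hunit v).trans ?_
    exact mul_le_mul_of_nonneg_right (le_max_left _ _) hLpos.le
  have hM₁b : ∀ v : ℝ, (((zeroIndexSet T).filter fun c ↦
      v ≤ normalizedOrdinate c ∧ normalizedOrdinate c ≤ v + 1).card : ℝ) ≤ M₁ := by
    intro v
    refine (card_filter_normalizedOrdinate_window_le hT0.le (hwinγ T hT₁) v).trans ?_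
    exact mul_le_mul_of_nonneg_right (le_max_right _ _) hLpos.le
  -- the master estimate
  have hmaster := sum_norm_sub_weight_mul_le hCg hK hdec hlip hT hlogL rfl hτ hy₀ hY3 hM0 hYL hR
    hwin' hM₁a hM₁b
  refine hmaster.trans ?_
  -- sizes: `N ≥ TL/4π`, `#low ≤ N(T/L²) ≤ C_N T/L`
  set N : ℝ := (zetaZeroCount T : ℝ) with hNdef
  have hNpos : 0 < N := lt_of_lt_of_le (by positivity) hNT
  have hlowcard : (((zeroIndexSet T).filter fun c ↦
      zetaOrdinate c < T / Real.log T ^ 2).card : ℝ) ≤ C_N * (T / Real.log T) := by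
    have h1 : ((zeroIndexSet T).filter fun c ↦ zetaOrdinate c < T / Real.log T ^ 2).card ≤
        zetaZeroCount (T / Real.log T ^ 2) := by
      have hsub : ((zeroIndexSet T).filter fun c ↦ zetaOrdinate c < T / Real.log T ^ 2) ⊆
          Finset.range (zetaZeroCount (T / Real.log T ^ 2)) := by
        intro c hc
        rw [Finset.mem_filter] at hc
        exact Finset.mem_range.2 (riemann_von_mangoldt_holds.zetaOrdinate_le_iff.1 hc.2.le)
      simpa using Finset.card_le_card hsub
    have h2 : Real.log (T / Real.log T ^ 2) ≤ Real.log T :=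
      Real.log_le_log (by positivity) (div_le_self hT0.le (by nlinarith))
    calc (((zeroIndexSet T).filter fun c ↦ zetaOrdinate c < T / Real.log T ^ 2).card : ℝ)
        ≤ zetaZeroCount (T / Real.log T ^ 2) := by exact_mod_cast h1
      _ ≤ C_N * (T / Real.log T ^ 2 * Real.log (T / Real.log T ^ 2)) := hlowT
      _ ≤ C_N * (T / Real.log T ^ 2 * Real.log T) := by gcongr
      _ = C_N * (T / Real.log T) := by field_simp
  -- compare each term with `N`
  have hTL : T * Real.log T ≤ 4 * π * N := by
    rw [div_le_iff₀ (by positivity)] at hNT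
    linarith
  have hτ0 : 0 ≤ (2 * Real.log (Real.log T) + 1) / Real.log T := by positivity
  exact master_bound_le_eps_mul hCg hK hC0 hC₂0 hC_N hy₀ hε hLpos hT0 hNpos hτ0 hY0 hden0
    (Nat.cast_nonneg _) (Nat.floor_le (by positivity)) hTL hlowcard hYfar hΦT

end RudnickSarnak

end Literature.NumberTheory.LFunctions

end
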